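import Summits.FinalStateConjecture.FinalStateConjecture.Theorems.EIHFluxBalanceInertialRecessionStubSlaving3FarFieldPrep

/-!
# Route EIHFluxBalance — `InertialRecession`, line `sublinear-is-free-clean-window-charges`:
# far-field derivatives of a painted Schwarzschild summand are polynomial in the EFFECTIVE jets
# (slaving stub `stub_slaving`, fact "F3": cross-hole decoupling, `a = 0`)

Helper file for the crux `stmt-FinalStateConjecture-10166`
(`Summit.FinalStateConjecture.FinalStateConjecture.Theses.EIHFluxBalance.InertialRecession`),
stub `stub_slaving`.

* `exists_norm_iteratedFDeriv_schwarzschildSummand_le_pow` — **capstone (F3, a = 0)**: for every order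
  `m` and Lorentz bound `γ` there is `C` with
  `‖Dᵐ[y ↦ boostedKerrBilin (Λ(y⁰)) (y⁰, ξ(y⁰)) M 0 y − η](x)‖ ≤ Γᵐ |M| C / ‖x̲ − ξ(x⁰)‖`
  whenever `‖(Λe₀)⁽ᵏ⁾(x⁰)‖ ≤ Γᵏ`, `‖ξ⁽ᵏ⁾(x⁰)‖ ≤ Γᵏ` (`1 ≤ k ≤ m`), `Γ ≥ 1`, `‖x̲ − ξ(x⁰)‖ ≥ 1`:
  the representative of `…StubSlaving3FarFieldPrep` (pure boost of the lab velocity, time-reflected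
  if `Λ` reverses time; the sign is constant along a continuous motion), the degree laws for
  `v = ũ/u⁰` and `boostCLM(−v)`, and the degree law `exists_norm_iteratedFDeriv_ksPert_frame_le_pow`
  of `…StubSlaving3JetScaling`.

Rotating holes (`a ≠ 0`) need the analogous "untwisting" representative modulo the axial symmetry
(see the worker hand-off); the Schwarzschild case shows the mechanism and covers clause 1–2 of
`SLAVED³` for non-rotating configurations.
-/

set_option linter.dupNamespace false
set_option maxSynthPendingDepth 3

noncomputable section

open scoped Topology ContDiff Nat
open Filter Set Function Metric Literature.Geometry.Lorentzian
  Summit.FinalStateConjecture.FinalStateConjecture.Theorems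
  Summit.FinalStateConjecture.FinalStateConjecture.Theorems.SublinearIsFree

namespace Summit.FinalStateConjecture.FinalStateConjecture.Theorems.SublinearIsFree.Slaving

/-! ### Capstone: far-field derivatives of a painted Schwarzschild summand in the effective jets -/

-- operator-norm instance paths on form-valued multilinear maps are slow to unify
set_option synthInstance.maxHeartbeats 200000 in
set_option maxHeartbeats 1600000 in
/-- **Far-field derivatives of a painted Schwarzschild summand are polynomial in the EFFECTIVE jets
(F3, `a = 0`).** For every order `m` and Lorentz bound `γ ≥ 1` there is `C ≥ 0` such that for all
`M`, all `Cᵐ` motions `Λ : ℝ → O(1,3)` (as operator paths), `ξ : ℝ → E3` with `|(Λ(s)e₀)⁰| ≤ γ`,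
every scale `Γ ≥ 1`, every lab time `t` with `‖(Λ e₀)⁽ᵏ⁾(t)‖ ≤ Γᵏ`, `‖ξ⁽ᵏ⁾(t)‖ ≤ Γᵏ` (`1 ≤ k ≤ m`) and
every point `x` of the slab `{x⁰ = t}` with `‖x̲ − ξ(t)‖ ≥ 1`:
`‖Dᵐ[y ↦ boostedKerrBilin (Λ(y⁰)) (y⁰, ξ(y⁰)) M 0 y − η](x)‖ ≤ Γᵐ |M| C / ‖x̲ − ξ(t)‖`.
Only the jets of the painted `4`-velocity `Λ e₀` and of the centre enter — not those of the operator
path `Λ` (representatives `boostedKerrBilin_zero_spin_eq_boost_repr` /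
`…_eq_reflect_boost_repr`, degree laws for `v = ũ/u⁰` and `boostCLM(−v)`, and the degree law of
`…StubSlaving3JetScaling`). This is how the other holes decouple from hole `i` in the slaving
analysis even though no jet is bounded a priori. [folklore] -/
theorem exists_norm_iteratedFDeriv_schwarzschildSummand_le_pow (m : ℕ) {γ : ℝ} (hγ : 1 ≤ γ) :
    ∃ C : ℝ, 0 ≤ C ∧ ∀ (M : ℝ) (Λ : ℝ → lorentzGroup) (ξ : ℝ → E3) (t : ℝ) (x : E4) (Γ : ℝ),
      ContDiff ℝ m (fun s ↦ ((Λ s : E4 ≃L[ℝ] E4) : E4 →L[ℝ] E4)) → ContDiff ℝ m ξ →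
      (∀ s, |((Λ s : E4 ≃L[ℝ] E4) (E4.basisVector 0)) 0| ≤ γ) → 1 ≤ Γ →
      (∀ k, 1 ≤ k → k ≤ m →
        ‖iteratedDeriv k (fun s ↦ (Λ s : E4 ≃L[ℝ] E4) (E4.basisVector 0)) t‖ ≤ Γ ^ k) →
      (∀ k, 1 ≤ k → k ≤ m → ‖iteratedDeriv k ξ t‖ ≤ Γ ^ k) →
      x 0 = t → 1 ≤ ‖E4.spatial x - ξ t‖ →
      ‖iteratedFDeriv ℝ m (fun y : E4 ↦ boostedKerrBilin (Λ (y 0)) (E4.ofTimeSpace (y 0) (ξ (y 0)))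
        M 0 y - Minkowski.bilin) x‖ ≤ Γ ^ m * (|M| * C / ‖E4.spatial x - ξ t‖) := by
  -- the uniform speed bound
  set κ₀ : ℝ := Real.sqrt (1 - (γ ^ 2)⁻¹) with hκ₀
  have hκ₀1 : κ₀ < 1 := by
    rw [hκ₀, Real.sqrt_lt' one_pos, one_pow]
    have : 0 < (γ ^ 2)⁻¹ := by positivity
    linarith
  obtain ⟨C₁, hC₁0, hC₁⟩ := exists_norm_iteratedDeriv_labVelocity_le_pow m γ
  obtain ⟨C₂, hC₂0, hC₂⟩ := exists_norm_iteratedDeriv_boostCLM_neg_le_pow m hκ₀1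
  set C₁' : ℝ := max C₁ 1 with hC₁'
  have hC₁'1 : 1 ≤ C₁' := le_max_right _ _
  set Γ₀ : ℝ := max (C₂ * C₁' ^ m) 2 with hΓ₀
  have hΓ₀1 : 1 ≤ Γ₀ := le_trans (by norm_num) (le_max_right _ _)
  obtain ⟨C, hC0, hC⟩ := exists_norm_iteratedFDeriv_ksPert_frame_le_pow m hΓ₀1
  refine ⟨C, hC0, fun M Λ ξ t x Γ hΛ hξ hγb hΓ hub hξb hx hd ↦ ?_⟩
  have hΓ0 : 0 ≤ Γ := zero_le_one.trans hΓ
  -- the painted 4-velocity and lab velocity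
  set u : ℝ → E4 := fun s ↦ (Λ s : E4 ≃L[ℝ] E4) (E4.basisVector 0) with hu
  have huc : ContDiff ℝ m u := hΛ.clm_apply contDiff_const
  have hu1 : ∀ s, 1 ≤ |u s 0| := fun s ↦ one_le_abs_lorentz_apply_zero (Λ s)
  have hu0 : ∀ s, u s 0 ≠ 0 := fun s h ↦ by
    have := hu1 s; rw [h, abs_zero] at this; exact absurd this (by norm_num)
  set v : ℝ → E3 := fun s ↦ ((u s) 0)⁻¹ • E4.spatial (u s) with hv
  have hvc : ContDiff ℝ m v := contDiff_labVelocity huc hu0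
  have hfacts : ∀ s, v s ∈ closedBall (0 : E3) κ₀ ∧ ‖u s‖ ≤ 2 * γ ∧ Lorentz.gamma (v s) = |u s 0| :=
    fun s ↦ labVelocity_facts (Λ s) (hγb s)
  have hvκ : ∀ s, ‖v s‖ ≤ κ₀ := fun s ↦ by simpa using (hfacts s).1
  have hvlt : ∀ s, ‖v s‖ < 1 := fun s ↦ (hvκ s).trans_lt hκ₀1
  -- jets of `v` and of the rest-frame boost at `t`
  have hvb : ∀ i, 1 ≤ i → i ≤ m → ‖iteratedDeriv i v t‖ ≤ (C₁' * Γ) ^ i := by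
    intro i hi1 hi
    have h1 := hC₁ u t Γ hΓ huc (hu1 t) (hfacts t).2.1 hub i hi
    calc ‖iteratedDeriv i v t‖ ≤ C₁ * Γ ^ i := h1
      _ ≤ C₁' * Γ ^ i := by gcongr; exact le_max_left _ _
      _ ≤ C₁' ^ i * Γ ^ i := by
          gcongr
          · exact le_self_pow₀ hC₁'1 (by omega)
      _ = (C₁' * Γ) ^ i := (mul_pow _ _ _).symm
  have hC₁'Γ : 1 ≤ C₁' * Γ := one_le_mul_of_one_le_of_one_le hC₁'1 hΓ
  have hBb : ∀ j ≤ m, ‖iteratedDeriv j (fun s ↦ Lorentz.boostCLM (-v s)) t‖ ≤ Γ₀ * Γ ^ j := by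
    intro j hj
    have h1 := hC₂ v t (C₁' * Γ) hC₁'Γ hvc (hvκ t) hvb j hj
    calc ‖iteratedDeriv j (fun s ↦ Lorentz.boostCLM (-v s)) t‖ ≤ C₂ * (C₁' * Γ) ^ j := h1
      _ = (C₂ * C₁' ^ j) * Γ ^ j := by rw [mul_pow]; ring
      _ ≤ (C₂ * C₁' ^ m) * Γ ^ j := by gcongr
      _ ≤ Γ₀ * Γ ^ j := by gcongr; exact le_max_left _ _
  have hBc : ContDiff ℝ m (fun s ↦ Lorentz.boostCLM (-v s)) := contDiff_boostCLM_neg_comp hvc hvlt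
  -- the time reflection as an operator
  set Tclm : E4 →L[ℝ] E4 := ContinuousLinearMap.id ℝ E4 -
    (2 : ℝ) • ContinuousLinearMap.smulRight (EuclideanSpace.proj (0 : Fin 4)) (E4.basisVector 0) with hTclm
  have hTapply : ∀ w : E4, Tclm w = w - (2 * w 0) • E4.basisVector 0 := fun w ↦ by
    simp [hTclm, smul_smul]
  have hTnorm : ‖Tclm‖ ≤ 1 :=
    ContinuousLinearMap.opNorm_le_bound _ zero_le_one fun w ↦ by
      rw [hTapply, PseudotensorBound.norm_reflect, one_mul]
  -- the sign of `u⁰` is constant along the motion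
  have hsign : (∀ s, 0 < u s 0) ∨ (∀ s, u s 0 < 0) := by
    have hcont : Continuous (fun s ↦ u s 0) :=
      (EuclideanSpace.proj (0 : Fin 4)).continuous.comp huc.continuous
    by_cases h : 0 < u t 0
    · refine Or.inl fun s ↦ ?_
      by_contra hs
      push Not at hs
      obtain ⟨r, hr⟩ := mem_range_of_exists_le_of_exists_ge hcont ⟨s, hs⟩ ⟨t, h.le⟩
      exact hu0 r hr
    · refine Or.inr fun s ↦ ?_
      have ht : u t 0 < 0 := lt_of_le_of_ne (not_lt.1 h) (hu0 t)
      by_contra hs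
      push Not at hs
      obtain ⟨r, hr⟩ := mem_range_of_exists_le_of_exists_ge hcont ⟨t, ht.le⟩ ⟨s, hs⟩
      exact hu0 r hr
  -- a representative rest-frame path `Θ` with controlled jets
  obtain ⟨Θ, hΘc, hΘb, hrepr, hiso, hstretch⟩ : ∃ Θ : ℝ → E4 →L[ℝ] E4, ContDiff ℝ m Θ ∧
      (∀ j ≤ m, ‖iteratedDeriv j Θ t‖ ≤ Γ₀ * Γ ^ j) ∧
      (∀ (s : ℝ) (c y V W : E4), boostedKerrBilin (Λ s) c M 0 y V W =
        Kerr.bilin M 0 (Θ s (y - c)) (Θ s V) (Θ s W)) ∧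
      (∀ (s : ℝ) (V W : E4), Minkowski.bilin (Θ s V) (Θ s W) = Minkowski.bilin V W) ∧
      (∀ w : E4, w 0 = 0 → ‖w‖ ≤ E4.spatialNorm (Θ t w)) := by
    have hboost : ∀ s, (Lorentz.boost (v s) (hvlt s) : E4 ≃L[ℝ] E4) (E4.basisVector 0) =
        (|u s 0| * (u s 0)⁻¹) • u s := fun s ↦ boost_labVelocity_apply_basisVector_zero (Λ s) (hvlt s)
    have hstretchB : ∀ w : E4, w 0 = 0 → ‖w‖ ≤ E4.spatialNorm (Lorentz.boostCLM (-v t) w) := by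
      intro w hw
      have h1 := norm_le_spatialNorm_lorentz_apply (Lorentz.boost (v t) (hvlt t))⁻¹ hw
      rwa [coe_lorentz_inv, ← ContinuousLinearEquiv.coe_coe, coe_boost_symm' (hvlt t)] at h1
    have hvv : ∀ s, ‖-v s‖ < 1 := fun s ↦ by rw [norm_neg]; exact hvlt s
    rcases hsign with hpos | hneg
    · refine ⟨fun s ↦ Lorentz.boostCLM (-v s), hBc, hBb, fun s c y V W ↦ ?_, fun s V W ↦
        Lorentz.minkowski_boostCLM (hvv s) V W, hstretchB⟩
      have hΛv : (Lorentz.boost (v s) (hvlt s) : E4 ≃L[ℝ] E4) (E4.basisVector 0) =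
          (Λ s : E4 ≃L[ℝ] E4) (E4.basisVector 0) := by
        rw [hboost, abs_of_pos (hpos s), mul_inv_cancel₀ (hu0 s), one_smul]
      exact boostedKerrBilin_zero_spin_eq_boost_repr (Λ s) (hvlt s) hΛv M c y V W
    · refine ⟨fun s ↦ Tclm.comp (Lorentz.boostCLM (-v s)), ?_, ?_, fun s c y V W ↦ ?_,
        fun s V W ↦ ?_, fun w hw ↦ ?_⟩
      · exact ((ContinuousLinearMap.compL ℝ E4 E4 E4) Tclm).contDiff.comp hBc
      · intro j hj
        have h1 := ((ContinuousLinearMap.compL ℝ E4 E4 E4) Tclm).norm_iteratedFDeriv_comp_left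
          (f := fun s ↦ Lorentz.boostCLM (-v s)) (x := t) (n := j) hBc.contDiffAt
          (by exact_mod_cast hj)
        have hL : ‖(ContinuousLinearMap.compL ℝ E4 E4 E4) Tclm‖ ≤ 1 :=
          ((ContinuousLinearMap.compL ℝ E4 E4 E4).le_opNorm Tclm).trans
            (by nlinarith [ContinuousLinearMap.norm_compL_le (𝕜 := ℝ) (E := E4) (Fₗ := E4) (Gₗ := E4),
              norm_nonneg Tclm, hTnorm])
        rw [← norm_iteratedFDeriv_eq_norm_iteratedDeriv]
        refine h1.trans ?_
        rw [norm_iteratedFDeriv_eq_norm_iteratedDeriv]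
        calc ‖(ContinuousLinearMap.compL ℝ E4 E4 E4) Tclm‖ *
              ‖iteratedDeriv j (fun s ↦ Lorentz.boostCLM (-v s)) t‖
            ≤ 1 * (Γ₀ * Γ ^ j) := mul_le_mul hL (hBb j hj) (norm_nonneg _) zero_le_one
          _ = Γ₀ * Γ ^ j := one_mul _
      · have hΛv : (Lorentz.boost (v s) (hvlt s) : E4 ≃L[ℝ] E4) (E4.basisVector 0) =
            -(Λ s : E4 ≃L[ℝ] E4) (E4.basisVector 0) := by
          rw [hboost, abs_of_neg (hneg s), neg_mul, mul_inv_cancel₀ (hu0 s), neg_smul, one_smul]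
        rw [boostedKerrBilin_zero_spin_eq_reflect_boost_repr (Λ s) (hvlt s) hΛv M c y V W]
        simp only [ContinuousLinearMap.comp_apply, hTapply]
      · have hTiso : ∀ a b : E4, Minkowski.bilin (a - (2 * a 0) • E4.basisVector 0)
            (b - (2 * b 0) • E4.basisVector 0) = Minkowski.bilin a b := fun a b ↦ by
          simp only [Minkowski.bilin_apply, PseudotensorBound.reflect_apply, Fin.succ_ne_zero]
          simp
        simp only [ContinuousLinearMap.comp_apply, hTapply, hTiso]
        exact Lorentz.minkowski_boostCLM (hvv s) V W
      · have h1 := hstretchB w hw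
        have h2 : E4.spatialNorm (Tclm (Lorentz.boostCLM (-v t) w)) =
            E4.spatialNorm (Lorentz.boostCLM (-v t) w) := by
          rw [hTapply]
          unfold E4.spatialNorm
          congr 1
          ext i
          rw [E4.spatial_apply, E4.spatial_apply, PseudotensorBound.reflect_apply]
          simp [Fin.succ_ne_zero]
        rw [ContinuousLinearMap.comp_apply, h2]
        exact h1
  -- the painted summand through the representative
  set cc : ℝ → E4 := fun s ↦ E4.ofTimeSpace s (ξ s) with hcc
  have hccc : ContDiff ℝ m cc := by
    have hsplit : cc = fun s : ℝ ↦ s • E4.basisVector 0 + E4.spaceEmbed (ξ s) :=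
      funext fun s ↦ E4.ofTimeSpace_eq_smul_add' s (ξ s)
    rw [hsplit]
    exact (contDiff_id.smul contDiff_const).add (E4.spaceEmbed.contDiff.comp hξ)
  have hfield : (fun y : E4 ↦ boostedKerrBilin (Λ (y 0)) (E4.ofTimeSpace (y 0) (ξ (y 0))) M 0 y -
      Minkowski.bilin) = fun y ↦ (Kerr.bilin M 0 (Θ (y 0) (y - cc (y 0))) -
        Minkowski.bilin).bilinearComp (Θ (y 0)) (Θ (y 0)) := by
    funext y
    ext V W
    rw [sub_apply, sub_apply, ContinuousLinearMap.bilinearComp_apply, sub_apply, sub_apply, hrepr,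
      hiso]
  -- jets of the centre
  have hcb : ∀ k, 1 ≤ k → k ≤ m → ‖iteratedDeriv k cc (x 0)‖ ≤ Γ₀ * Γ ^ k := by
    intro k hk1 hk
    rw [hx]
    have h1 := norm_iteratedDeriv_centre_le hξ t hk1 (by exact_mod_cast hk)
    have h2 := hξb k hk1 hk
    have h3 : (1 : ℝ) ≤ Γ ^ k := one_le_pow₀ hΓ
    calc ‖iteratedDeriv k cc t‖ ≤ 1 + ‖iteratedDeriv k ξ t‖ := h1
      _ ≤ 2 * Γ ^ k := by linarith
      _ ≤ Γ₀ * Γ ^ k := by gcongr; exact le_max_right _ _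
  have hΘb' : ∀ k ≤ m, ‖iteratedDeriv k Θ (x 0)‖ ≤ Γ₀ * Γ ^ k := fun k hk ↦ by rw [hx]; exact hΘb k hk
  -- geometry at `x`
  obtain ⟨h0, hn⟩ := sub_ofTimeSpace_apply_zero hx (ξ t)
  have hxc : ‖x - cc (x 0)‖ ≤ ‖E4.spatial x - ξ t‖ := by
    show ‖x - E4.ofTimeSpace (x 0) (ξ (x 0))‖ ≤ _
    rw [hx, hn]
  have hsp : ‖E4.spatial x - ξ t‖ ≤ E4.spatialNorm (Θ (x 0) (x - cc (x 0))) := by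
    show _ ≤ E4.spatialNorm (Θ (x 0) (x - E4.ofTimeSpace (x 0) (ξ (x 0))))
    rw [hx, ← hn]
    exact hstretch _ h0
  have hd' : max 1 (2 * |(0 : ℝ)|) ≤ ‖E4.spatial x - ξ t‖ := by simpa using hd
  have key := hC M 0 Θ cc x ‖E4.spatial x - ξ t‖ Γ hΓ hΘc hccc hΘb' hcb hd' hxc hsp
  rw [hfield]
  exact key

-- operator-norm instance paths on form-valued multilinear maps are slow to unify
set_option synthInstance.maxHeartbeats 200000 in
/-- **Registered sub-goal form** (worker carrier `slaving_schwarzschildSummand_farField_pow` of the crux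
item) of `exists_norm_iteratedFDeriv_schwarzschildSummand_le_pow`: far-field derivatives of a painted
Schwarzschild summand are polynomial in the effective jets. [folklore] -/
theorem slaving_schwarzschildSummand_farField_pow : open Literature.Geometry.Lorentzian in ∀ (m : ℕ) {γ : ℝ}, 1 ≤ γ → ∃ C : ℝ, 0 ≤ C ∧ ∀ (M : ℝ) (Λ : ℝ → lorentzGroup) (ξ : ℝ → E3) (t : ℝ) (x : E4) (Γ : ℝ), ContDiff ℝ m (fun s ↦ ((Λ s : E4 ≃L[ℝ] E4) : E4 →L[ℝ] E4)) → ContDiff ℝ m ξ → (∀ s, |((Λ s : E4 ≃L[ℝ] E4) (E4.basisVector 0)) 0| ≤ γ) → 1 ≤ Γ → (∀ k, 1 ≤ k → k ≤ m → ‖iteratedDeriv k (fun s ↦ (Λ s : E4 ≃L[ℝ] E4) (E4.basisVector 0)) t‖ ≤ Γ ^ k) → (∀ k, 1 ≤ k → k ≤ m → ‖iteratedDeriv k ξ t‖ ≤ Γ ^ k) → x 0 = t → 1 ≤ ‖E4.spatial x - ξ t‖ → ‖iteratedFDeriv ℝ m (fun y : E4 ↦ boostedKerrBilin (Λ (y 0))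 (E4.ofTimeSpace (y 0) (ξ (y 0))) M 0 y - Minkowski.bilin) x‖ ≤ Γ ^ m * (|M| * C / ‖E4.spatial x - ξ t‖) :=
  fun m _ hγ ↦ exists_norm_iteratedFDeriv_schwarzschildSummand_le_pow m hγ

end Summit.FinalStateConjecture.FinalStateConjecture.Theorems.SublinearIsFree.Slaving

end
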